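import Summits.ResolutionOfSingularities.ResolutionOfSingularities.Theorems.FrobeniusClosingSteerWords12MemberDatum
import HarnessLib

/-!
# Crux `Steer` (stmt-ResolutionOfSingularities-16345), chain W4.1 — **a ℕ-valued quantity that does not increase across consecutive point steps
# is EVENTUALLY CONSTANT on the point steps** (hS1b proof map (M3); pure logic over `IsPointStep` / `IsVisitPair`; Theses-free, def-free)

OURS (campaign `res-hironaka`, rung L ★L-G4, slot W4.1; seat res-D-lib-2 g10 on res-L0-w41-plan-1 RULING 264(d) = the hS1b kernel, res-L0-w41-strat-2 g4's
PROOF MAP hS1b v0.9 step (M3) «CONSTANCY: a non-increasing ℕ-valued sequence on the (infinite) set of late point steps is eventually constant — pure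
logic over (M2)»). The quantity is an arbitrary function `d : ℕ → ℕ` (the assembly instantiates it with the reduced order chosen at each stage); the
monotonicity hypothesis is asked only across LATE VISIT PAIRS `IsVisitPair R P j j'` (`j ≥ i₀`), which is what (M2) = D·S3 delivers. Candidates, not facts;
nothing here is a statement of H. Hironaka's manuscript [Hironaka2017] (status: under review). AI-written; AI review is weaker than expert review.

* `exists_isVisitPair_of_pointStep` — after a point step `j` there is a NEXT point step `j'`, and `(j, j')` is a visit pair (point steps recur).
* `le_of_pointSteps_of_visitPairs` — monotonicity across late visit pairs ⇒ monotonicity across any two late point steps `j ≤ j'`.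
* **`eventually_const_of_visitPairs`** — hence `d` is eventually constant on the point steps: `∃ i₁ c, ∀ i ≥ i₁, IsPointStep R P i → d i = c`
  (the minimum of `d` over late point steps is attained and then kept).
[folklore]
-/

-- `Summit.<S>.<S>.…` duplicates the summit name by design (single-problem summit).
set_option linter.dupNamespace false

open Summit.ResolutionOfSingularities.ResolutionOfSingularities.Theorems.SwitchingDichotomy.Words

namespace Summit.ResolutionOfSingularities.ResolutionOfSingularities.Theorems.SwitchingDichotomy.VisitSequence

variable {K : Type} [Field K] (R : ℕ → Subring K) (P : (i : ℕ) → Ideal (R i))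

/-- After a point step `j` there is a next point step, forming a VISIT PAIR with `j` (when point steps recur). OURS. [folklore] -/
theorem exists_isVisitPair_of_pointStep (hrec : ∀ i₀ : ℕ, ∃ i, i₀ ≤ i ∧ IsPointStep R P i) {j : ℕ} (hj : IsPointStep R P j) :
    ∃ j', IsVisitPair R P j j' := by
  classical
  have hex : ∃ i, j < i ∧ IsPointStep R P i := by
    obtain ⟨i, hi, hpt⟩ := hrec (j + 1)
    exact ⟨i, by omega, hpt⟩
  refine ⟨Nat.find hex, (Nat.find_spec hex).1, hj, (Nat.find_spec hex).2, fun l hjl hlj hpt => ?_⟩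
  exact Nat.find_min hex hlj ⟨hjl, hpt⟩

/-- Monotonicity across late visit pairs gives monotonicity across any two late point steps. OURS. [folklore] -/
theorem le_of_pointSteps_of_visitPairs (hrec : ∀ i₀ : ℕ, ∃ i, i₀ ≤ i ∧ IsPointStep R P i) (d : ℕ → ℕ) {i₀ : ℕ}
    (hstep : ∀ j j', i₀ ≤ j → IsVisitPair R P j j' → d j' ≤ d j) :
    ∀ j j', i₀ ≤ j → j ≤ j' → IsPointStep R P j → IsPointStep R P j' → d j' ≤ d j := by
  -- strong induction on the distance `j' - j`
  suffices h : ∀ n, ∀ j j', j' - j ≤ n → i₀ ≤ j → j ≤ j' → IsPointStep R P j → IsPointStep R P j' → d j' ≤ d j from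
    fun j j' h0 hle hj hj' => h (j' - j) j j' le_rfl h0 hle hj hj'
  intro n
  induction n with
  | zero =>
    intro j j' hn _ hle _ _
    have : j' = j := by omega
    rw [this]
  | succ n ih =>
    intro j j' hn h0 hle hj hj'
    rcases Nat.eq_or_lt_of_le hle with rfl | hlt
    · exact le_rfl
    obtain ⟨j₁, hvisit⟩ := exists_isVisitPair_of_pointStep R P hrec hj
    obtain ⟨hjj₁, -, hj₁, hmin⟩ := hvisit
    -- the next point step `j₁` is `≤ j'`
    have hj₁j' : j₁ ≤ j' := by
      by_contra hlt'
      exact hmin j' hlt (not_le.mp hlt') hj'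
    have h1 : d j₁ ≤ d j := hstep j j₁ h0 ⟨hjj₁, hj, hj₁, hmin⟩
    have h2 : d j' ≤ d j₁ := ih j₁ j' (by omega) (by omega) hj₁j' hj₁ hj'
    exact h2.trans h1

/-- **EVENTUAL CONSTANCY.** If point steps recur and `d` does not increase across late visit pairs, then `d` is eventually constant on the point
steps. OURS. [folklore] -/
theorem eventually_const_of_visitPairs (hrec : ∀ i₀ : ℕ, ∃ i, i₀ ≤ i ∧ IsPointStep R P i) (d : ℕ → ℕ) {i₀ : ℕ}
    (hstep : ∀ j j', i₀ ≤ j → IsVisitPair R P j j' → d j' ≤ d j) :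
    ∃ i₁ c : ℕ, i₀ ≤ i₁ ∧ IsPointStep R P i₁ ∧ d i₁ = c ∧ ∀ i, i₁ ≤ i → IsPointStep R P i → d i = c := by
  classical
  -- the set of values of `d` at late point steps is nonempty; take its minimum
  have hne : ∃ m, ∃ i, i₀ ≤ i ∧ IsPointStep R P i ∧ d i = m := by
    obtain ⟨i, hi, hpt⟩ := hrec i₀
    exact ⟨d i, i, hi, hpt, rfl⟩
  obtain ⟨i₁, hi₁, hpt₁, hd₁⟩ := Nat.find_spec hne
  refine ⟨i₁, d i₁, hi₁, hpt₁, rfl, fun i hi hpt => le_antisymm ?_ ?_⟩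
  · exact le_of_pointSteps_of_visitPairs R P hrec d hstep i₁ i hi₁ hi hpt₁ hpt
  · rw [hd₁]
    exact Nat.find_min' hne ⟨i, le_trans hi₁ hi, hpt, rfl⟩

end Summit.ResolutionOfSingularities.ResolutionOfSingularities.Theorems.SwitchingDichotomy.VisitSequence
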